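/-
Origin: expansion seat `planner-pub-hodgecm-pv04-g7-0`, handover #1 2026-08-18T12:31:33Z md5 7f7005cf81f1ac88e83205958db6bf47 ; new (L1, additive leaf; imports Mathlib + HodgeCM.CM.ReflexInflateDict, no rewrite) (`HOME/pub-hodgecm-pv04-g7/lean/Pv04g7/TypeOfDet.lean`, md5 7f7005cf, 323 lines);
landed by the gen-8 packager in gate run 29 as `HodgeCM/CM/TypeOfDet.lean` (verbatim).
-/
/-
Copyright: pub-hodgecm formalisation cell (harness21, 2026). New file (not vendored).
Origin: HOME/pub-hodgecm-pv04-g7/lean/Pv04g7/TypeOfDet.lean (WIP module `Pv04g7.TypeOfDet`; intended final place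
`HodgeCM/CM/TypeOfDet.lean` = module `HodgeCM.CM.TypeOfDet`, CONTRIBUTING §3 kind L1: pure CM combinatorics over Mathlib +
the landed `HodgeCM.CM.ReflexInflateDict` / `HodgeCM.PerL34.ReflexWelldef`; no `Universe`, no facts) (seat
planner-pub-hodgecm-pv04-g7-0, DAG-node prover #04 gen 7, seam S6 / node N12a, dictionary reading R3 of
`HodgeCM.Universe.ThetaModel.Fact_thetaAlbanese`).
-/
import Mathlib
import Summits.HodgeConjecture.HodgeCM.CM.ReflexInflateDict

/-!
# The CM type is determined by the determinant character; the double reflex inflates back to the type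

KERNEL versions of the two hand inferences recorded in `HOME/GAPS.md` entry pv04g3-C3 (and named as the "RESIDUAL of
R3" in pv01g2-A1): the derivation, from [Liu21] Def 4.5(1) ("for every `x ∈ M_μ`, the determinant of the action of
`i_μ(x)` on the `E`-vector space `Lie_E(A_μ)` equals `N_μ(x)`", arXiv:2102.11518 p0018 L67, with `N_μ = N'_μ ∘ N_{M_μ/M'_μ}`,
`N'_μ` the reflex norm of `(E, Φ_μ)`, p0018 L55–58) alone, that the `M_μ`-CM type of `A_μ ⊗_{E,ι₁} ℂ` is the INFLATION of
the reflex type `Φ'_μ` (not of its conjugate), and that inflating `Φ'_μ` further to `K` gives back `Ψ` (not `Ψ̄`).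
Three lemmas, all Mathlib-only:

* (A) `finset_eq_of_prod_apply_eq` — MULTIPLICATIVE INDEPENDENCE OF EMBEDDINGS: a finite set `Θ` of ring embeddings of a
  number field `M` into a field `E` of characteristic zero is determined by its product character `x ↦ ∏_{θ ∈ Θ} θ x`
  on `M ∖ {0}`.  (Proof: for a primitive element `α` and `t ∈ ℚ`, `∏_{θ∈Θ} (t - θ α)` is a polynomial identity in `t`;
  equal monic split polynomials have equal root multisets; `θ ↦ θ α` is injective.)  This is the step "by multiplicative
  independence of the embeddings of a number field (Zariski density of `M_μ^×` in `Res G_m` / Artin) the index sets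
  agree" of pv04g3-C3 (2).
* (B) `prod_norm_eq_prod_filter_comp` — TYPE NORM OF AN INFLATED SET: for a tower `k : M' →+* M` of number fields, a finite
  set `S` of embeddings `M' →+* E` (`E` algebraically closed of characteristic zero) and `x ∈ M`,
  `∏_{σ' ∈ S} σ' (N_{M/M'} x) = ∏_{θ : θ ∘ k ∈ S} θ x` (Mathlib `Algebra.norm_eq_prod_embeddings`, fibrewise).  With (A):
  `type_eq_inflate_of_det` — if the product character of `Θ` is `x ↦ ∏_{σ'∈S} σ'(N_{M/M'} x)` (Def 4.5(1) read on
  `Lie ⊗_{E,ι₁} ℂ = ⊕_{θ∈Θ} ℂ_θ`, with `ι₁ ∘ N'_μ = ∏_{σ' ∈ Φ'_μ} σ'` the DEFINITION of the reflex norm), then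
  `Θ = {θ : θ ∘ k ∈ S}` = the inflation of `S`.
* (C) `image_doubleReflex_eq` — DOUBLE REFLEX, at group level in the language of `HodgeCM.PerL34.ReflexWelldef` ([Y1neg] v2
  l. 183: `A_Φ := {τ : τ⁻¹ ∘ φ^h ∈ Φ}`, `Φ^* := A_Φ|_{K^*_Φ}`, `K^*_Φ` the fixed field of `Stab(Φ)`): for a group `G` acting
  transitively on `E ∋ φh` and `Φ ⊆ E`, put `A := aSet Φ φh ⊆ G` (the inflation to the big field of the reflex type, cf.
  `CMTypeOps.reflexInflateSet_eq`), and apply the SAME construction to `A` (big field acting on itself, base point `1`):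
  `A₂ := aSet A 1 = A⁻¹`, `Stab₂ := Stab(A)`.  Then `Stab(φh) ≤ Stab₂` (`stabilizer_le_stabilizer_aSet`: the second reflex
  field lies inside `φh(K)`) and `{g • φh : g ∈ A₂ · Stab₂} = Φ` (`image_doubleReflex_eq`: the second reflex type, inflated
  to `K`, is `Φ` itself; restriction to the fixed field of `Stab₂` is identified with the left coset of `Stab₂`, as in
  `ReflexWelldef.mem_aSet_iff_exists_coset` — for finite Galois `L/ℚ` this is Mathlib's
  `IntermediateField.fixingSubgroup_fixedField`) — pv04g3-C3 (3).  `isPretransitive_autHom` discharges the transitivity hypothesis of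
  `ReflexWelldef` for `G = Aut L`, `E = Hom(K, L)`, `L/ℚ` Galois (any two embeddings of `K` into `L` differ by an
  automorphism of `L`, Mathlib `AlgHom.liftNormal`), and `doubleReflex_pullType_eq` is (C) in that instance, for the set
  `A = aSet (pullType ι₁ Ψ) j` whose `ι₁`-image is prl2-g3's `Φ(Ψ) = reflexInflateSet j ι₁ Ψ` (pv01-g2
  `CMTypeOps.reflexInflateSet_eq`).

What is NOT claimed: the two PRINT readings these lemmas are applied to — [Liu21] Def 4.5(1) itself and "`Lie_E(A_μ) ⊗_{E,ι₁} ℂ`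
is the direct sum of the eigenlines of a multiplicity-free set `Θ` of `[M_μ:ℚ]/2` embeddings" (`H¹_B(A_μ, ℚ)` free of rank
one over `M_μ`, p0023 L1) — stay print (FACTS class P), as does the identification of Liu's reflex-type convention (Def 4.3)
with [Y1neg]'s `A_Φ` (both are the Shimura–Taniyama reflex).  No new constant, no axiom, no proof placeholder.
-/

set_option autoImplicit false

open scoped Pointwise

namespace HodgeCM
namespace CMTypeOps

open Polynomial

/-! ### (A) Multiplicative independence of the embeddings of a number field -/

section Independence

variable {M : Type*} [Field M] [NumberField M] {E : Type*} [Field E] [CharZero E]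

/-- Two ring embeddings of a number field that agree on a primitive element are equal. -/
theorem ringHom_eq_of_apply_gen_eq (θ θ' : M →+* E)
    (h : θ (Field.powerBasisOfFiniteOfSeparable ℚ M).gen = θ' (Field.powerBasisOfFiniteOfSeparable ℚ M).gen) :
    θ = θ' := by
  have key : θ.toRatAlgHom = θ'.toRatAlgHom :=
    (Field.powerBasisOfFiniteOfSeparable ℚ M).algHom_ext (by simpa [RingHom.toRatAlgHom_apply] using h)
  have := congrArg AlgHom.toRingHom key
  simpa [RingHom.toRatAlgHom_toRingHom] using this

/-- `θ ↦ θ α` is injective for a primitive element `α`. -/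
theorem apply_gen_injective :
    Function.Injective (fun θ : M →+* E => θ (Field.powerBasisOfFiniteOfSeparable ℚ M).gen) :=
  fun θ θ' h => ringHom_eq_of_apply_gen_eq θ θ' h

/-- **Multiplicative independence of embeddings.**  A finite set `Θ` of ring embeddings `M →+* E` of a number field `M`
into a field `E` of characteristic zero is determined by the product character `x ↦ ∏_{θ ∈ Θ} θ x` on `M ∖ {0}`:
if `∏_{θ ∈ Θ} θ x = ∏_{θ ∈ Θ'} θ x` for all `x ≠ 0`, then `Θ = Θ'`. -/
theorem finset_eq_of_prod_apply_eq {Θ Θ' : Finset (M →+* E)}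
    (h : ∀ x : M, x ≠ 0 → ∏ θ ∈ Θ, θ x = ∏ θ ∈ Θ', θ x) : Θ = Θ' := by
  classical
  set α : M := (Field.powerBasisOfFiniteOfSeparable ℚ M).gen with hα
  -- the two polynomials `∏ (X - θ α)`
  set P : E[X] := ((Θ.val.map fun θ : M →+* E => θ α).map fun a => X - C a).prod with hP
  set P' : E[X] := ((Θ'.val.map fun θ : M →+* E => θ α).map fun a => X - C a).prod with hP'
  have hevalP : ∀ t : E, P.eval t = ∏ θ ∈ Θ, (t - θ α) := by
    intro t
    rw [hP, Multiset.map_map, Polynomial.eval_multiset_prod, Multiset.map_map]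
    simp only [Function.comp_def, eval_sub, eval_X, eval_C]
    rfl
  have hevalP' : ∀ t : E, P'.eval t = ∏ θ ∈ Θ', (t - θ α) := by
    intro t
    rw [hP', Multiset.map_map, Polynomial.eval_multiset_prod, Multiset.map_map]
    simp only [Function.comp_def, eval_sub, eval_X, eval_C]
    rfl
  -- they agree at every rational `t` with `t ≠ α`
  have hagree : ∀ t : ℚ, (t : M) ≠ α → P.eval (t : E) = P'.eval (t : E) := by
    intro t ht
    have hx : (t : M) - α ≠ 0 := sub_ne_zero.mpr ht
    have := h _ hx
    simp only [map_sub, map_ratCast] at this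
    rw [hevalP, hevalP']
    exact this
  -- hence they are equal
  have hPP' : P = P' := by
    apply Polynomial.eq_of_infinite_eval_eq
    have hfin : {t : ℚ | (t : M) = α}.Finite :=
      Set.Subsingleton.finite fun t ht t' ht' => Rat.cast_injective (α := M) (ht.trans ht'.symm)
    have hinf : {t : ℚ | (t : M) ≠ α}.Infinite := by
      have := hfin.infinite_compl
      simpa [Set.compl_setOf] using this
    refine Set.Infinite.mono ?_ (hinf.image (Rat.cast_injective (α := E)).injOn)
    rintro _ ⟨t, ht, rfl⟩
    exact hagree t ht
  -- equal root multisets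
  have hroots : Θ.val.map (fun θ : M →+* E => θ α) = Θ'.val.map (fun θ : M →+* E => θ α) := by
    have h1 : P.roots = Θ.val.map (fun θ : M →+* E => θ α) := by
      rw [hP]; exact roots_multiset_prod_X_sub_C _
    have h2 : P'.roots = Θ'.val.map (fun θ : M →+* E => θ α) := by
      rw [hP']; exact roots_multiset_prod_X_sub_C _
    rw [← h1, ← h2, hPP']
  exact Finset.val_inj.mp (Multiset.map_injective apply_gen_injective hroots)

/-- The same with the (stronger) hypothesis at every `x`. -/
theorem finset_eq_of_prod_apply_eq' {Θ Θ' : Finset (M →+* E)}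
    (h : ∀ x : M, ∏ θ ∈ Θ, θ x = ∏ θ ∈ Θ', θ x) : Θ = Θ' :=
  finset_eq_of_prod_apply_eq fun x _ => h x

/-- Set form (every set of embeddings of a number field is finite). -/
theorem set_eq_of_finprod_apply_eq {Θ Θ' : Set (M →+* E)}
    (h : ∀ x : M, x ≠ 0 → ∏ᶠ θ ∈ Θ, θ x = ∏ᶠ θ ∈ Θ', θ x) : Θ = Θ' := by
  classical
  have hΘ : Θ.Finite := Set.toFinite Θ
  have hΘ' : Θ'.Finite := Set.toFinite Θ'
  have key : hΘ.toFinset = hΘ'.toFinset := by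
    refine finset_eq_of_prod_apply_eq fun x hx => ?_
    rw [← finprod_mem_eq_finite_toFinset_prod _ hΘ, ← finprod_mem_eq_finite_toFinset_prod _ hΘ']
    exact h x hx
  simpa using congrArg (fun s : Finset (M →+* E) => (s : Set (M →+* E))) key

end Independence


/-! ### (B) The type norm of an inflated set of embeddings; the type from the determinant character -/

section TypeNorm

variable {M' M : Type*} [Field M'] [NumberField M'] [Field M] [NumberField M] [Algebra M' M]
  {E : Type*} [Field E] [CharZero E] [IsAlgClosed E]

/-- `σ' (N_{M/M'} x) = ∏_{θ : θ|_{M'} = σ'} θ x` (Mathlib `Algebra.norm_eq_prod_embeddings`, re-indexed by ring embeddings). -/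
theorem apply_norm_eq_prod_filter [DecidableEq (M' →+* E)] (σ' : M' →+* E) (x : M) :
    σ' (Algebra.norm M' x) = ∏ θ ∈ Finset.univ.filter (fun θ : M →+* E => θ.comp (algebraMap M' M) = σ'), θ x := by
  haveI : IsScalarTower ℚ M' M := IsScalarTower.of_algebraMap_eq' (Subsingleton.elim _ _)
  haveI : FiniteDimensional M' M := Module.Finite.of_restrictScalars_finite ℚ M' M
  letI : Algebra M' E := σ'.toAlgebra
  have h := Algebra.norm_eq_prod_embeddings M' E x
  rw [RingHom.algebraMap_toAlgebra] at h
  rw [h]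
  symm
  refine Finset.prod_bij (fun θ hθ => ({ θ with commutes' := fun a => ?_ } : M →ₐ[M'] E)) ?_ ?_ ?_ ?_
  · have := RingHom.congr_fun (Finset.mem_filter.mp hθ).2 a
    simpa [RingHom.algebraMap_toAlgebra] using this
  · intro θ hθ
    exact Finset.mem_univ _
  · intro θ₁ _ θ₂ _ h12
    exact RingHom.ext fun y => by simpa using AlgHom.congr_fun h12 y
  · intro σ _
    refine ⟨σ.toRingHom, Finset.mem_filter.mpr ⟨Finset.mem_univ _, RingHom.ext fun a => ?_⟩, ?_⟩
    · exact σ.commutes a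
    · ext y; rfl
  · intro θ hθ
    rfl

/-- **Type norm of an inflated set**: `∏_{σ' ∈ S} σ' (N_{M/M'} x) = ∏_{θ : θ|_{M'} ∈ S} θ x`. -/
theorem prod_norm_eq_prod_filter_comp [DecidableEq (M' →+* E)] (S : Finset (M' →+* E)) (x : M) :
    ∏ σ' ∈ S, σ' (Algebra.norm M' x) =
      ∏ θ ∈ Finset.univ.filter (fun θ : M →+* E => θ.comp (algebraMap M' M) ∈ S), θ x := by
  rw [← Finset.prod_fiberwise_eq_prod_filter Finset.univ S (fun θ : M →+* E => θ.comp (algebraMap M' M))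
    (fun θ => θ x)]
  exact Finset.prod_congr rfl fun σ' _ => apply_norm_eq_prod_filter σ' x

/-- **The type from the determinant character** (pv04g3-C3 (2)): if the product character of a finite set `Θ` of
embeddings of `M` is `x ↦ ∏_{σ' ∈ S} σ' (N_{M/M'} x)` on `M ∖ {0}` — [Liu21] Def 4.5(1) `det(i_μ(x) | Lie_E A_μ) = N'_μ(N_{M_μ/M'_μ} x)`
read on `Lie ⊗_{E,ι₁} ℂ = ⊕_{θ ∈ Θ} ℂ_θ`, with `ι₁ ∘ N'_μ = ∏_{σ' ∈ Φ'_μ} σ'` the definition of the reflex norm, `S = Φ'_μ` —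
then `Θ` is the INFLATION `{θ : θ|_{M'} ∈ S}` of `S` (for `S = Φ'.1` and the algebra structure `k.toAlgebra` this set is the
carrier of `CMTypeOps.inflate k Φ'` of `HodgeCM.PerL34.ThetaSubOfLiu`, by `rfl`). -/
theorem type_eq_inflate_of_det [DecidableEq (M' →+* E)] (S : Finset (M' →+* E)) (Θ : Finset (M →+* E))
    (hdet : ∀ x : M, x ≠ 0 → ∏ θ ∈ Θ, θ x = ∏ σ' ∈ S, σ' (Algebra.norm M' x)) :
    Θ = Finset.univ.filter (fun θ : M →+* E => θ.comp (algebraMap M' M) ∈ S) :=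
  finset_eq_of_prod_apply_eq fun x hx => by rw [hdet x hx, prod_norm_eq_prod_filter_comp]

/-- Set form of `type_eq_inflate_of_det`: `Θ = {θ | θ ∘ algebraMap ∈ S}`. -/
theorem set_eq_inflate_of_det (S : Set (M' →+* E)) (Θ : Set (M →+* E))
    (hdet : ∀ x : M, x ≠ 0 → ∏ᶠ θ ∈ Θ, θ x = ∏ᶠ σ' ∈ S, σ' (Algebra.norm M' x)) :
    Θ = {θ : M →+* E | θ.comp (algebraMap M' M) ∈ S} := by
  classical
  have hS : S.Finite := Set.toFinite S
  have hΘ : Θ.Finite := Set.toFinite Θ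
  have key : hΘ.toFinset = Finset.univ.filter (fun θ : M →+* E => θ.comp (algebraMap M' M) ∈ hS.toFinset) := by
    refine type_eq_inflate_of_det hS.toFinset hΘ.toFinset fun x hx => ?_
    rw [← finprod_mem_eq_finite_toFinset_prod _ hΘ, ← finprod_mem_eq_finite_toFinset_prod _ hS]
    exact hdet x hx
  have := congrArg (fun s : Finset (M →+* E) => (s : Set (M →+* E))) key
  simpa [Set.ext_iff] using this

end TypeNorm

/-! ### (C) The double reflex, at group level (`ReflexWelldef.aSet`) -/

section DoubleReflex

open HodgeCM.PerL34.ReflexWelldef (aSet mem_aSet)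

variable {G : Type*} [Group G] {E : Type*} [MulAction G E]

/-- `Stab(φh) ≤ Stab(A_Φ)` (left multiplication): the reflex field of the inflated reflex type lies inside `φh(K)`
(`Stab(φh) = Gal(big field / φh K)`). -/
theorem stabilizer_le_stabilizer_aSet (Φ : Set E) (φh : E) :
    MulAction.stabilizer G φh ≤ MulAction.stabilizer G (aSet Φ φh : Set G) := by
  intro s hs
  rw [MulAction.mem_stabilizer_iff] at hs ⊢
  ext g
  rw [Set.mem_smul_set_iff_inv_smul_mem, smul_eq_mul, mem_aSet, mem_aSet, mul_inv_rev, inv_inv, mul_smul, hs]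

/-- The second `A`-set (base point `1`, the big field acting on itself) is `A⁻¹ = {g : g • φh ∈ Φ}` (`= Φ̃` of [Y1neg] l. 190). -/
theorem mem_aSet_aSet_one_iff (Φ : Set E) (φh : E) (g : G) :
    g ∈ (aSet (aSet Φ φh : Set G) (1 : G) : Set G) ↔ g • φh ∈ Φ := by
  rw [mem_aSet, smul_eq_mul, mul_one, mem_aSet, inv_inv]

/-- Membership in `A₂ · Stab₂` is membership in `A₂` (`A₂` is right-`Stab₂`-invariant because `Stab₂ · A = A`). -/
theorem mem_doubleReflex_iff (Φ : Set E) (φh : E) (g : G) :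
    g ∈ (aSet (aSet Φ φh : Set G) (1 : G) : Set G) * (MulAction.stabilizer G (aSet Φ φh : Set G) : Set G) ↔
      g • φh ∈ Φ := by
  constructor
  · rintro ⟨a, ha, s, hs, rfl⟩
    rw [mem_aSet_aSet_one_iff] at ha
    rw [SetLike.mem_coe, MulAction.mem_stabilizer_iff] at hs
    -- `a s φh ∈ Φ ⟺ (a s)⁻¹ ∈ A ⟺ s⁻¹ a⁻¹ ∈ A ⟺ a⁻¹ ∈ s • A = A ⟺ a φh ∈ Φ`
    have h1 : a⁻¹ ∈ (aSet Φ φh : Set G) := by rw [mem_aSet, inv_inv]; exact ha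
    rw [← hs, Set.mem_smul_set_iff_inv_smul_mem, smul_eq_mul, mem_aSet, mul_inv_rev, inv_inv, inv_inv] at h1
    exact h1
  · intro hg
    exact ⟨g, (mem_aSet_aSet_one_iff Φ φh g).mpr hg, 1, (MulAction.stabilizer G (aSet Φ φh : Set G)).one_mem, mul_one g⟩

/-- **Double reflex** (pv04g3-C3 (3), group level): `{g • φh : g ∈ A₂ · Stab₂} = Φ` for a transitive action — the reflex
type of the inflated reflex type `A_Φ`, inflated back to `K` along `φh`, is `Φ` itself (not its conjugate). -/
theorem image_doubleReflex_eq [MulAction.IsPretransitive G E] (Φ : Set E) (φh : E) :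
    (fun g : G => g • φh) ''
        ((aSet (aSet Φ φh : Set G) (1 : G) : Set G) * (MulAction.stabilizer G (aSet Φ φh : Set G) : Set G)) = Φ := by
  ext x
  constructor
  · rintro ⟨g, hg, rfl⟩
    exact (mem_doubleReflex_iff Φ φh g).mp hg
  · intro hx
    obtain ⟨g, rfl⟩ := MulAction.exists_smul_eq G φh x
    exact ⟨g, (mem_doubleReflex_iff Φ φh g).mpr hx, rfl⟩

end DoubleReflex

/-! ### (C') The instance `G = Aut L`, `E = Hom(K, L)` of `ReflexInflateDict` -/

section Fields

open Literature.AlgebraicGeometry.Motives (CMType)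
open HodgeCM.PerL34.ReflexWelldef (aSet mem_aSet)

variable {K L : CMField}

/-- Any two embeddings of `K` into the Galois CM field `L` differ by an automorphism of `L`. -/
theorem exists_ringEquiv_comp_eq (hL : IsGalois ℚ L) (j j' : K →+* L) :
    ∃ g : L ≃+* L, g.toRingHom.comp j = j' := by
  haveI := hL
  letI : Algebra K L := j.toAlgebra
  haveI : IsScalarTower ℚ K L := IsScalarTower.of_algebraMap_eq' (Subsingleton.elim _ _)
  let ϕ : K →ₐ[ℚ] L := j'.toRatAlgHom
  let ψ : L →ₐ[ℚ] L := ϕ.liftNormal L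
  refine ⟨(AlgEquiv.ofBijective ψ (Algebra.IsAlgebraic.algHom_bijective ψ)).toRingEquiv, RingHom.ext fun x => ?_⟩
  have h := AlgHom.liftNormal_commutes ϕ L x
  rw [Algebra.algebraMap_self, RingHom.id_apply] at h
  exact h

/-- The transitivity hypothesis of `ReflexWelldef` holds for `Aut L` acting on `Hom(K, L)` (`L/ℚ` Galois). -/
theorem isPretransitive_autHom (hL : IsGalois ℚ L) : MulAction.IsPretransitive (L ≃+* L) (K →+* L) :=
  ⟨fun j j' => by
    obtain ⟨g, hg⟩ := exists_ringEquiv_comp_eq hL j j'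
    exact ⟨g, hg⟩⟩

/-- **pv04g3-C3 (3) in the PerL instance.**  With `A := aSet (pullType ι₁ Ψ) j` (so that `ι₁ ∘ A = Φ(Ψ) = reflexInflateSet j ι₁ Ψ`,
`CMTypeOps.reflexInflateSet_eq`), `A₂ := aSet A 1`, `Stab₂ := Stab(A)`: the embeddings `g ∘ j`, `g ∈ A₂ · Stab₂` — the
inflation to `K` (along `j`) of the reflex type of `(L, Φ(Ψ))` — are exactly those with `ι₁ ∘ g ∘ j ∈ Ψ`. -/
theorem doubleReflex_pullType_eq (hL : IsGalois ℚ L) (j : K →+* L) (ι₁ : L →+* ℂ) (Ψ : CMType K) :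
    (fun g : L ≃+* L => g • j) ''
        ((aSet (aSet (pullType ι₁ Ψ) j : Set (L ≃+* L)) (1 : L ≃+* L) : Set (L ≃+* L)) *
          (MulAction.stabilizer (L ≃+* L) (aSet (pullType ι₁ Ψ) j : Set (L ≃+* L)) : Set (L ≃+* L))) =
      pullType ι₁ Ψ := by
  haveI := isPretransitive_autHom (K := K) hL
  exact image_doubleReflex_eq (pullType ι₁ Ψ) j

/-- The same read in `Hom(K, ℂ)`: `ι₁ ∘ g ∘ j ∈ Ψ ⟺ g ∈ A₂ · Stab₂`. -/
theorem comp_mem_iff_mem_doubleReflex (j : K →+* L) (ι₁ : L →+* ℂ) (Ψ : CMType K) (g : L ≃+* L) :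
    ι₁.comp (g.toRingHom.comp j) ∈ Ψ.1 ↔
      g ∈ (aSet (aSet (pullType ι₁ Ψ) j : Set (L ≃+* L)) (1 : L ≃+* L) : Set (L ≃+* L)) *
        (MulAction.stabilizer (L ≃+* L) (aSet (pullType ι₁ Ψ) j : Set (L ≃+* L)) : Set (L ≃+* L)) := by
  rw [mem_doubleReflex_iff, smul_def, mem_pullType]

/-- The reflex field of `(L, Φ(Ψ))` lies inside `j(K)`: `Gal(L/jK) = Stab(j) ≤ Stab₂`. -/
theorem stabilizer_le_stabilizer_reflexSet (j : K →+* L) (ι₁ : L →+* ℂ) (Ψ : CMType K) :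
    MulAction.stabilizer (L ≃+* L) j ≤
      MulAction.stabilizer (L ≃+* L) (aSet (pullType ι₁ Ψ) j : Set (L ≃+* L)) :=
  stabilizer_le_stabilizer_aSet (pullType ι₁ Ψ) j

end Fields

end CMTypeOps
end HodgeCM
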